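import Mathlib
import Literature.Geometry.Lorentzian.Basic
import HarnessLib
import Literature.Uncategorized.NearIdInjOpen

/-!
# W1 — near-identity self-maps of `E4` are co-Lipschitz and open

If `P : E4 → E4` is differentiable on a convex open set `K` with `‖DP‖ ≤ 1/2` there, then
`x ↦ x + P x` is `2`-co-Lipschitz on `K` (hence injective) and maps open subsets of `K` to open
sets.

Main declarations: `NearIdInjOpen` (the statement registered as stub W1 of the `NeckGapDecay`
skeleton v7, verbatim) and `stub_nearIdInjOpen : Literature.Uncategorized.NearIdInjOpen`.

Proof (pure Mathlib): the mean value inequality on the convex set `K`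
(`Convex.norm_image_sub_le_of_norm_fderiv_le`) gives `‖P x - P y‖ ≤ ½ ‖x - y‖` for `x, y ∈ K`;
the co-Lipschitz bound is then the triangle inequality, and for an open `V ⊆ K` the map
`id + P` approximates the identity equivalence on `V` with constant `1/2 < 1 = ‖id⁻¹‖⁻¹`
(`ApproximatesLinearOn`), so `ApproximatesLinearOn.open_image` (the surjectivity-on-balls step of
the inverse function theorem) gives that the image of `V` is open.
-/

open Literature.Geometry.Lorentzian

namespace Summit.FinalStateConjecture.FinalStateConjecture.Theorems.NeckGapDecay.ConnectionLevelCones.NearIdInjOpenStub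
set_option linter.dupNamespace false

/-- Mean value inequality on a convex set: `‖DP‖ ≤ 1/2` on `K` gives
`‖P x - P y‖ ≤ ½ ‖x - y‖` for `x, y ∈ K`. [folklore] -/
private lemma norm_sub_le_half {P : E4 → E4} {K : Set E4} (hKc : Convex ℝ K)
    (hdiff : ∀ x ∈ K, DifferentiableAt ℝ P x) (hbound : ∀ x ∈ K, ‖fderiv ℝ P x‖ ≤ 1 / 2)
    {x y : E4} (hx : x ∈ K) (hy : y ∈ K) : ‖P x - P y‖ ≤ 1 / 2 * ‖x - y‖ :=
  hKc.norm_image_sub_le_of_norm_fderiv_le hdiff hbound hy hx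

/-- A `½`-contraction perturbation of the identity is `2`-co-Lipschitz (triangle inequality).
[folklore] -/
private lemma norm_sub_le_two_mul {P : E4 → E4} {x y : E4} (h : ‖P x - P y‖ ≤ 1 / 2 * ‖x - y‖) :
    ‖x - y‖ ≤ 2 * ‖(x + P x) - (y + P y)‖ := by
  have h1 : ‖x - y‖ ≤ ‖(x + P x) - (y + P y)‖ + ‖P x - P y‖ := by
    have he : x - y = ((x + P x) - (y + P y)) - (P x - P y) := by abel
    calc ‖x - y‖ = ‖((x + P x) - (y + P y)) - (P x - P y)‖ := by rw [← he]
      _ ≤ ‖(x + P x) - (y + P y)‖ + ‖P x - P y‖ := norm_sub_le _ _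
  linarith

/-- On a set where `P` is a `½`-contraction, `id + P` approximates the identity equivalence with
constant `1/2` in the sense of `ApproximatesLinearOn`. [folklore] -/
private lemma approximatesLinearOn_id_add {P : E4 → E4} {V : Set E4}
    (h : ∀ x ∈ V, ∀ y ∈ V, ‖P x - P y‖ ≤ 1 / 2 * ‖x - y‖) :
    ApproximatesLinearOn (fun x ↦ x + P x)
      ((ContinuousLinearEquiv.refl ℝ E4 : E4 ≃L[ℝ] E4) : E4 →L[ℝ] E4) V (1 / 2) := by
  intro x hx y hy
  have h1 := h x hx y hy
  have he : (x + P x) - (y + P y) - (x - y) = P x - P y := by abel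
  have hc : ((1 / 2 : NNReal) : ℝ) = 1 / 2 := by norm_num
  simpa [he, hc] using h1

/-- The identity equivalence of the nontrivial space `E4`, seen as a nonlinear right inverse of
itself, has norm `1`, so the constant `1/2` is admissible in `ApproximatesLinearOn.open_image`.
[folklore] -/
private lemma half_lt_inv_nnnorm_refl :
    (1 / 2 : NNReal) < ((ContinuousLinearEquiv.refl ℝ E4).toNonlinearRightInverse.nnnorm)⁻¹ := by
  have h : (ContinuousLinearEquiv.refl ℝ E4).toNonlinearRightInverse.nnnorm =
      ‖((ContinuousLinearEquiv.refl ℝ E4).symm : E4 →L[ℝ] E4)‖₊ := rfl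
  rw [h, ContinuousLinearEquiv.refl_symm, ContinuousLinearEquiv.coe_refl,
    ContinuousLinearMap.nnnorm_id, inv_one]
  rw [one_div, NNReal.inv_lt_one_iff two_ne_zero]
  exact one_lt_two

/-- **W1 — near-identity self-maps, proved**: the mean value inequality on the convex `K` makes `P`
a `½`-contraction on `K`, whence the `2`-co-Lipschitz bound by the triangle inequality; for an open
`V ⊆ K`, `id + P` approximates the identity equivalence on `V` with constant `1/2 < 1`, and
`ApproximatesLinearOn.open_image` gives that `(id + P) '' V` is open. [folklore] -/
theorem stub_nearIdInjOpen : Literature.Uncategorized.NearIdInjOpen := by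
  intro P K _hK hKc hdiff hbound
  refine ⟨fun x hx y hy ↦ norm_sub_le_two_mul (norm_sub_le_half hKc hdiff hbound hx hy),
    fun V hV hVK ↦ ?_⟩
  have hA := approximatesLinearOn_id_add (P := P)
    (fun x hx y hy ↦ norm_sub_le_half hKc hdiff hbound (hVK hx) (hVK hy))
  exact hA.open_image (ContinuousLinearEquiv.refl ℝ E4).toNonlinearRightInverse hV
    (Or.inr half_lt_inv_nnnorm_refl)

end Summit.FinalStateConjecture.FinalStateConjecture.Theorems.NeckGapDecay.ConnectionLevelCones.NearIdInjOpenStub
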